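import Summits.QuantumFields.BalabanUV.Beta.GAN24.HarmonicPeriodicTwoForm
import Summits.QuantumFields.BalabanUV.Beta.GAN24.WardResidualSUnroll
import Literature.MathematicalPhysics.QuantumFieldTheory.Balaban1983to89.Beta.KKTFluctuationEnergy

/-!
# `BalabanUV.Beta.GAN24.ContourSumCellAdjoint` — binder row G-an2-4 ∕ (CONV-C), conservation law (C) AT LEVELS `j ≥ 1`, the (γ) hand's
# «DEPTH TOWER» (memo `HOME/b2b-balaban-gan24-formalise-leaf-06/g54/C-LEVELS-GE1-g54.md` §29, letter K5a): **CELL ADJOINTNESS OF THE STRAIGHT-CONTOUR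
# BLOCK SUM** — for a fine 1-form `p` of period `L·N` and a coarse 1-form `F` of period `N`,
# `Σ_{x ∈ box (L·N)} Σ_a p_a(x)·(𝒬ᵀF)_a(x) = Σ_{y ∈ box N} Σ_a (𝒬p)_a(y)·F_a(y)` (`sum_box_mul_contourSumAdj`).

NOT IN PRINT; OUR BOOKKEEPING ([folklore] change of variables on the discrete torus, over `AffineAveraging.contourSum` (`𝒬`), `AffineReproduction.contourSumAdj`
(`𝒬ᵀ`), an2's `KKTFluctuationEnergy` (`contourSumAdj_eq`, `quo_zsmul_add_toSite`), `BlochFibreUniqueness.quo_add_zsmul`, leaf-04's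
`HarmonicPeriodicTwoForm.sum_box_shift` and `WardResidualSUnroll.sum_box_mul` BY NAME; G-an2-4 formalisation swarm, leaf prover
`b2b-balaban-gan24-formalise-leaf-06`, gen 54).  HONEST FRAMING (cell contract, verbatim): «discharging `BetaPertH` makes Bałaban's UV stability UNCONDITIONAL — a real
constructive-QFT result; it is NOT the continuum limit and NOT the Clay problem.»  HONEST DEPENDENCY (verbatim): «continuum YM on T⁴ ⇐ BetaPertH ∧ nine spine
estimates (0/9 proved); BetaPertH ⇐ (D1) ∧ (D4) ∧ CAP+tail; G-an2-4 gates asym, D1 and NE2/3/4.»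

WHY (the located use): the level bridge of the depth tower is the one-step covariance WITH its tent term
(`StepCovarianceSandwich.sandwich_inl_inl`: `E2_k·G_k·E2_k = wVH_k⁻¹·(E2_k − 𝒬ᵀ(…)𝒬)` on the `inl/inl` block); pairing it against period-`(L·N)` profiles on ONE
fine cell moves `𝒬ᵀ` across the cell pairing onto the other profile, landing on ONE coarse cell of period `N` — this file is exactly that move (the
lattice-level adjointness `KKTFluctuationEnergy.tsum_contourSumAdj` is its summable, non-periodic counterpart).

MECHANISM (generic dimension `D`, block `L ≥ 1`, coarse period `N ≥ 1`; finite sums only): expand `(𝒬ᵀF)_a(x) = Σ_{s<L} F_a(quo L (x − s·e_a))`; for fixed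
`(a,s)` the summand `x ↦ p_a(x)·F_a(quo L (x − s·e_a))` is `(L·N)`-periodic (`quo_add_zsmul` + the two periodicities), so the cell sum is invariant under the
shift `x ↦ x + s·e_a` (`sum_box_shift`); then split the fine cell `box (L·N) = L·(box N) + box L` (`sum_box_mul`) and read `quo L (L·y + b) = y`
(`quo_zsmul_add_toSite`): what remains is `Σ_y Σ_b Σ_s p_a(L·y + b + s·e_a)·F_a(y) = Σ_y (𝒬p)_a(y)·F_a(y)`.

WHAT ([folklore]; 0 `def`, 0 cited facts, 0 `def … : Prop`, 0 sorry): `sum_box_shift_quo` (the per-`(a,s)` identity) and `sum_box_mul_contourSumAdj`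
(+ the mirrored `sum_box_contourSumAdj_mul`).  Asserts NO value of Bałaban's tables; discharges NOTHING of (C) ∕ (C)sym ∕ (Q-D); NOT 33_j, NOT the
depth tower's level bridge itself (letter K5), NEVER «G-an2-4 closed» as (CONV-C); NOT D1, NOT `BetaPertH`, NOT continuum, NOT Clay.  2026-08-24; no existing
file touched.
-/

noncomputable section

open Finset
open scoped BigOperators
open Literature.MathematicalPhysics.QuantumFieldTheory
open Literature.MathematicalPhysics.QuantumFieldTheory.Balaban1983to89.Beta
open AffineAveraging (Form0 Form1 unitVec box toSite contourSum)
open AffineReproduction (contourSumAdj)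
open LatticeForm (quo)
open BlochFibreUniqueness (quo_add_zsmul)
open KKTFluctuationEnergy (contourSumAdj_eq quo_zsmul_add_toSite)
open PeriodicDescent (IsPeriodic)
open Summit.QuantumFields.BalabanUV.Beta.GAN24.HarmonicPeriodicTwoForm (sum_box_shift)
open Summit.QuantumFields.BalabanUV.Beta.GAN24.WardResidualSUnroll (sum_box_mul)

namespace Summit.QuantumFields.BalabanUV.Beta.GAN24.ContourSumCellAdjoint

variable {D L N : ℕ} [NeZero L] [NeZero N]

/-- [folklore] **ONE LEG OF `𝒬ᵀ` ON ONE FINE CELL**: for a fine 1-form `p` of period `L·N`, a coarse 1-form `F` of period `N`, a direction `a` and a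
contour offset `s`, `Σ_{x ∈ box (L·N)} p_a(x)·F_a(quo L (x − s·e_a)) = Σ_{y ∈ box N} Σ_{b ∈ box L} p_a(L·y + b + s·e_a)·F_a(y)` (shift the fine cell by
`s·e_a`, then split it into coarse points and block offsets). -/
theorem sum_box_shift_quo (p F : Form1 D ℝ) (hp : ∀ a x t, p a (x + ((L * N : ℕ) : ℤ) • t) = p a x)
    (hF : ∀ a y t, F a (y + (N : ℤ) • t) = F a y) (a : Fin D) (s : ℕ) :
    ∑ x ∈ box D (L * N), p a (toSite x) * F a (quo L (toSite x - (s : ℤ) • unitVec a))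
      = ∑ y ∈ box D N, ∑ b ∈ box D L, p a ((L : ℤ) • toSite y + toSite b + (s : ℤ) • unitVec a) * F a (toSite y) := by
  have hL : 1 ≤ L := Nat.one_le_iff_ne_zero.mpr (NeZero.ne L)
  have hper : IsPeriodic (L * N) (fun x => p a x * F a (quo L (x - (s : ℤ) • unitVec a))) := by
    intro x t
    simp only
    rw [hp a x t]
    congr 1
    rw [show x + ((L * N : ℕ) : ℤ) • t - (s : ℤ) • unitVec a = (x - (s : ℤ) • unitVec a) + (L : ℤ) • ((N : ℤ) • t) by
          rw [smul_smul, ← Nat.cast_mul]; abel,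
      quo_add_zsmul, hF]
  have hshift := sum_box_shift hper ((s : ℤ) • unitVec a)
  simp only [add_sub_cancel_right] at hshift
  rw [← hshift]
  have hB := sum_box_mul (E := ℝ) hL N (fun x => p a (x + (s : ℤ) • unitVec a) * F a (quo L x)) 0
  simp only [smul_zero, zero_add] at hB
  rw [hB]
  refine Finset.sum_congr rfl fun y _ => Finset.sum_congr rfl fun b hb => ?_
  rw [quo_zsmul_add_toSite (N := L) (toSite y) hb]

/-- [folklore] **CELL ADJOINTNESS OF THE STRAIGHT-CONTOUR BLOCK SUM**: for a fine 1-form `p` of period `L·N` and a coarse 1-form `F` of period `N`,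
`Σ_{x ∈ box (L·N)} Σ_a p_a(x)·(𝒬ᵀF)_a(x) = Σ_{y ∈ box N} Σ_a (𝒬p)_a(y)·F_a(y)` — the finite-cell counterpart of
`KKTFluctuationEnergy.tsum_contourSumAdj`. -/
theorem sum_box_mul_contourSumAdj (p F : Form1 D ℝ) (hp : ∀ a x t, p a (x + ((L * N : ℕ) : ℤ) • t) = p a x)
    (hF : ∀ a y t, F a (y + (N : ℤ) • t) = F a y) :
    ∑ x ∈ box D (L * N), ∑ a, p a (toSite x) * contourSumAdj L F a (toSite x)
      = ∑ y ∈ box D N, ∑ a, contourSum L p a (toSite y) * F a (toSite y) := by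
  have hLHS : ∑ x ∈ box D (L * N), ∑ a, p a (toSite x) * contourSumAdj L F a (toSite x)
      = ∑ a, ∑ s ∈ Finset.range L, ∑ x ∈ box D (L * N),
          p a (toSite x) * F a (quo L (toSite x - (s : ℤ) • unitVec a)) := by
    rw [Finset.sum_comm]
    refine Finset.sum_congr rfl fun a _ => ?_
    simp only [contourSumAdj_eq, Finset.mul_sum]
    exact Finset.sum_comm
  have hRHS : ∑ y ∈ box D N, ∑ a, contourSum L p a (toSite y) * F a (toSite y)
      = ∑ a, ∑ s ∈ Finset.range L, ∑ y ∈ box D N, ∑ b ∈ box D L,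
          p a ((L : ℤ) • toSite y + toSite b + (s : ℤ) • unitVec a) * F a (toSite y) := by
    rw [Finset.sum_comm]
    refine Finset.sum_congr rfl fun a _ => ?_
    simp only [contourSum, Finset.sum_mul]
    exact (Finset.sum_congr rfl fun y _ => Finset.sum_comm).trans Finset.sum_comm
  rw [hLHS, hRHS]
  exact Finset.sum_congr rfl fun a _ => Finset.sum_congr rfl fun s _ => sum_box_shift_quo p F hp hF a s

/-- [folklore] The mirrored reading `Σ_{x ∈ box (L·N)} Σ_a (𝒬ᵀF)_a(x)·p_a(x) = Σ_{y ∈ box N} Σ_a F_a(y)·(𝒬p)_a(y)`. -/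
theorem sum_box_contourSumAdj_mul (p F : Form1 D ℝ) (hp : ∀ a x t, p a (x + ((L * N : ℕ) : ℤ) • t) = p a x)
    (hF : ∀ a y t, F a (y + (N : ℤ) • t) = F a y) :
    ∑ x ∈ box D (L * N), ∑ a, contourSumAdj L F a (toSite x) * p a (toSite x)
      = ∑ y ∈ box D N, ∑ a, F a (toSite y) * contourSum L p a (toSite y) := by
  simp only [mul_comm (contourSumAdj L F _ _), mul_comm (F _ _) (contourSum L p _ _)]
  exact sum_box_mul_contourSumAdj p F hp hF

end Summit.QuantumFields.BalabanUV.Beta.GAN24.ContourSumCellAdjoint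

end
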